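import Literature.MathematicalPhysics.QuantumLattice.LiebRobinson
import Literature.MathematicalPhysics.QuantumLattice.LocalDynamics
import Literature.MathematicalPhysics.QuantumLattice.CorrelationLightCone
import HarnessLib

/-!
# The correlation light cone on `ℤ^d` from the Lieb–Robinson fact (BHV06 + NS06)

Trunk `MathematicalPhysics/QuantumLattice`, family `hubbard` (work item `wi-09505`). Companion of
`CorrelationLightCone.lean` (Bravyi–Hastings–Verstraete 2006, proved there in abstract form: a
Lieb–Robinson bound for the dynamics + exponential clustering of the state ⇒ connected
correlations cannot be created outside the light cone `L > 2v|t|`). This file supplies the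
Lieb–Robinson input from the tree's named fact `lieb_robinson` (Nachtergaele–Sims 2006 Thm 1,
`LiebRobinson.lean`) for the finite-volume Heisenberg dynamics
`τ_t^Λ = heisenbergEvolution (localHamiltonian (Φ.restrict Λ) univ) t` of a Hermitian finite-range
bounded interaction `Φ` on `ℤ^d`, and states the resulting light cone in the tree's `ℤ^d`
vocabulary (`Site d`, volumes `Λ : Finset (Site d)`, regions `X : Finset ↥Λ`, sup-metric `dist`):

* `lieb_robinson.commutator_bound` — from `lieb_robinson d q`: constants `C ≥ 0`, `ξ = 1/μ > 0`,
  `v > 0` with `‖[τ_t^Λ(A), B]‖ ≤ C |X| ‖A‖ ‖B‖ e^{-(L - v|t|)/ξ}` for `A ∈ 𝔄_X`, `B ∈ 𝔄_Y`,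
  `d(X, Y) ≥ L ≥ 0`, uniformly in `Λ` (the hypothesis `hLR` of the abstract theorem; the
  bookkeeping is `min(|X|,|Y|) ≤ |X|`, `L ≤ setDist` for nonempty regions, and the observation that
  observables supported on `∅` are scalars, which the dynamics fixes);
* `lieb_robinson.correlationLightCone` — **BHV06 on `ℤ^d`**: for every volume `Λ`, every
  norm-bounded functional `ω` on `𝔄_Λ` with `(c̃, χ)`-clustering and all `t`,
  `|⟨τ_t^Λ(A) τ_t^Λ(B)⟩_c| ≤ (2C(|X| + |Y|) + c̃) ‖A‖ ‖B‖ exp(-(L - 2v|t|)/(χ + 2ξ))`, with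
  `C, ξ, v` depending only on `Φ` (uniform in `Λ`, `ω`, `t`);
* small glue: `vectorState_apply_eq_opExpect` (`vectorState ψ A = opExpect A ψ`, `rfl`),
  `exists_eq_smul_one_of_isSupportedOn_empty` (`𝔄_∅ = ℂ𝟙`), `heisenbergEvolution_smul_one`,
  `inVolume_map_subtype`, `map_subtype_subset`, `le_setDist_of_forall`.

Sources: S. Bravyi, M. B. Hastings, F. Verstraete, PRL **97** (2006) 050401, arXiv:quant-ph/0603121
[BravyiHastingsVerstraete2006] (locators as in `CorrelationLightCone.lean`: "(LR)", "§corr",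
"Eq. (2)"); B. Nachtergaele, R. Sims, CMP **265** (2006) 119, Theorem 1 [NachtergaeleSims2006].
No new named fact is introduced; `lieb_robinson` enters as a hypothesis `(hLR : lieb_robinson d q)`.
-/

noncomputable section

open Matrix Complex Finset
open scoped Matrix.Norms.L2Operator

namespace Literature.MathematicalPhysics.QuantumLattice

variable {Λ : Type*} [Fintype Λ] [DecidableEq Λ] {q : ℕ}

section LatticeBridge

open Literature.Probability.LatticeModels

variable {d : ℕ}

/-- The vector-state functional is `opExpect` with the arguments swapped (definitional).
[cite: BravyiHastingsVerstraete2006, arXiv Eq. (2) ff.] -/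
theorem vectorState_apply_eq_opExpect {n : Type*} [Fintype n] (ψ : n → ℂ) (A : Matrix n n ℂ) :
    vectorState ψ A = opExpect A ψ := rfl

/-- An observable supported on the empty region is a scalar: `𝔄_∅ = ℂ 𝟙`. Bratteli–Robinson II
§6.2.1. [folklore] -/
theorem exists_eq_smul_one_of_isSupportedOn_empty {A : Op Λ q} (hA : IsSupportedOn A ∅) :
    ∃ a : ℂ, A = a • (1 : Op Λ q) := by
  obtain ⟨a, rfl⟩ := hA
  refine ⟨a (fun x => (Finset.notMem_empty x.1 x.2).elim) (fun x => (Finset.notMem_empty x.1 x.2).elim), ?_⟩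
  ext σ τ
  rw [localOp_apply, Matrix.smul_apply, one_apply, smul_eq_mul, mul_ite, mul_one, mul_zero]
  by_cases h : σ = τ
  · subst h
    rw [if_pos fun _ _ => rfl, if_pos rfl]
    congr 1 <;> exact funext fun x => (Finset.notMem_empty x.1 x.2).elim
  · rw [if_neg h, if_neg]
    intro h'
    exact h (funext fun y => h' y (Finset.notMem_empty y))

/-- The Heisenberg evolution fixes the scalars: `τ_t(a 𝟙) = a 𝟙`. Bratteli–Robinson II §6.2.1.
[folklore] -/
theorem heisenbergEvolution_smul_one {n : Type*} [Fintype n] [DecidableEq n] (H : Matrix n n ℂ)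
    (t : ℝ) (a : ℂ) : heisenbergEvolution H t (a • (1 : Matrix n n ℂ)) = a • (1 : Matrix n n ℂ) := by
  rw [heisenbergEvolution, Matrix.mul_smul, mul_one, Matrix.smul_mul, exp_smul_mul_exp_neg_smul]

/-- A region of the finite volume `↥Λ`, pushed to `ℤ^d` and pulled back with `inVolume`, is itself.
NS06 §2. [folklore] -/
theorem inVolume_map_subtype (Λ : Finset (Site d)) (X : Finset ↥Λ) :
    inVolume Λ (X.map (Function.Embedding.subtype _)) = X := by
  ext x
  simp only [mem_inVolume, Finset.mem_map, Function.Embedding.subtype_apply]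
  constructor
  · rintro ⟨y, hy, hyx⟩
    rwa [← Subtype.ext hyx]
  · intro hx
    exact ⟨x, hx, rfl⟩

/-- A region of `↥Λ` pushed to `ℤ^d` lies in `Λ`. NS06 §2. [folklore] -/
theorem map_subtype_subset (Λ : Finset (Site d)) (X : Finset ↥Λ) :
    X.map (Function.Embedding.subtype _) ⊆ Λ := fun _ hx => Finset.property_of_mem_map_subtype X hx

/-- A pointwise lower bound on the distances is a lower bound on `setDist` (nonempty regions).
NS06 §2. [folklore] -/
theorem le_setDist_of_forall {X Y : Finset (Site d)} (hX : X.Nonempty) (hY : Y.Nonempty) {L : ℝ}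
    (h : ∀ x ∈ X, ∀ y ∈ Y, L ≤ dist x y) : L ≤ setDist X Y := by
  obtain ⟨x, hx⟩ := hX
  obtain ⟨y, hy⟩ := hY
  haveI : Nonempty (↥X × ↥Y) := ⟨(⟨x, hx⟩, ⟨y, hy⟩)⟩
  exact le_ciInf fun p => h p.1 p.1.2 p.2 p.2.2

/-- **The Lieb–Robinson hypothesis of the abstract theorem from the tree's fact `lieb_robinson`.**
For a Hermitian, finite-range, bounded interaction `Φ` on `ℤ^d` there are `C ≥ 0`, `ξ > 0`,
`v > 0` such that in every finite volume `Λ`, for regions `X, Y ⊆ Λ` (as finite sets of the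
subtype `↥Λ`, with the sup-metric of `ℤ^d`) at distance `≥ L ≥ 0` and `A ∈ 𝔄_X`, `B ∈ 𝔄_Y`:
`‖[τ_t^Λ(A), B]‖ ≤ C |X| ‖A‖ ‖B‖ e^{-(L - v|t|)/ξ}` (`ξ = 1/μ`, `min(|X|,|Y|) ≤ |X|`; the empty
regions, where `setDist` has a junk value, are the scalar observables and commute with
everything). NS06 Thm 1 in the form BHV06 (LR). [cite: NachtergaeleSims2006, Theorem 1] -/
theorem lieb_robinson.commutator_bound (hLR : lieb_robinson d q) (Φ : LatticeInteraction d q)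
    {R J : ℝ} (hH : Φ.IsHermitian) (hR : Φ.HasFiniteRange R) (hJ : Φ.IsBounded J) :
    ∃ C ξ v : ℝ, 0 ≤ C ∧ 0 < ξ ∧ 0 < v ∧
      ∀ (Λ : Finset (Site d)) (t : ℝ) (X Y : Finset ↥Λ) (A B : Op ↥Λ q),
        IsSupportedOn A X → IsSupportedOn B Y → ∀ L : ℝ, 0 ≤ L →
          (∀ x ∈ X, ∀ y ∈ Y, L ≤ dist (x : Site d) (y : Site d)) →
          ‖heisenbergEvolution (localHamiltonian (Φ.restrict Λ) univ) t A * B -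
              B * heisenbergEvolution (localHamiltonian (Φ.restrict Λ) univ) t A‖ ≤
            C * X.card * ‖A‖ * ‖B‖ * Real.exp (-((L - v * |t|) / ξ)) := by
  obtain ⟨C, μ, v, hμ, hv, h⟩ := hLR Φ hH hR hJ
  refine ⟨max C 0, 1 / μ, v, le_max_right _ _, one_div_pos.2 hμ, hv, ?_⟩
  intro Λ t X Y A B hA hB L hL0 hL
  set τA := heisenbergEvolution (localHamiltonian (Φ.restrict Λ) univ) t A with hτA
  have hRHS : 0 ≤ max C 0 * X.card * ‖A‖ * ‖B‖ * Real.exp (-((L - v * |t|) / (1 / μ))) := by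
    positivity
  by_cases hX : X = ∅
  · -- `A` is a scalar
    subst hX
    obtain ⟨a, rfl⟩ := exists_eq_smul_one_of_isSupportedOn_empty hA
    rw [hτA, heisenbergEvolution_smul_one, Matrix.smul_mul, Matrix.mul_smul, one_mul, mul_one,
      sub_self, norm_zero]
    exact hRHS
  by_cases hY : Y = ∅
  · -- `B` is a scalar
    subst hY
    obtain ⟨b, rfl⟩ := exists_eq_smul_one_of_isSupportedOn_empty hB
    rw [Matrix.smul_mul, Matrix.mul_smul, one_mul, mul_one, sub_self, norm_zero]
    exact hRHS
  -- both regions nonempty: push them to `ℤ^d`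
  set X₀ : Finset (Site d) := X.map (Function.Embedding.subtype _) with hX₀
  set Y₀ : Finset (Site d) := Y.map (Function.Embedding.subtype _) with hY₀
  have hA₀ : IsSupportedOn A (inVolume Λ X₀) := by rwa [hX₀, inVolume_map_subtype]
  have hB₀ : IsSupportedOn B (inVolume Λ Y₀) := by rwa [hY₀, inVolume_map_subtype]
  have hmain := h Λ X₀ Y₀ (map_subtype_subset Λ X) (map_subtype_subset Λ Y) A B hA₀ hB₀ t
  have hX₀ne : X₀.Nonempty := by
    rw [hX₀, Finset.map_nonempty]; exact Finset.nonempty_iff_ne_empty.2 hX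
  have hY₀ne : Y₀.Nonempty := by
    rw [hY₀, Finset.map_nonempty]; exact Finset.nonempty_iff_ne_empty.2 hY
  have hdist : L ≤ setDist X₀ Y₀ := by
    refine le_setDist_of_forall hX₀ne hY₀ne fun x₀ hx₀ y₀ hy₀ => ?_
    obtain ⟨x, hx, rfl⟩ := Finset.mem_map.1 hx₀
    obtain ⟨y, hy, rfl⟩ := Finset.mem_map.1 hy₀
    exact hL x hx y hy
  have hcard : ((min X₀.card Y₀.card : ℕ) : ℝ) ≤ X.card := by
    have : min X₀.card Y₀.card ≤ X.card := (min_le_left _ _).trans (by rw [hX₀, Finset.card_map])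
    exact_mod_cast this
  have hexp : Real.exp (-μ * (setDist X₀ Y₀ - v * |t|)) ≤
      Real.exp (-((L - v * |t|) / (1 / μ))) := by
    rw [Real.exp_le_exp, div_div_eq_mul_div, div_one, neg_mul, neg_le_neg_iff, mul_comm]
    exact mul_le_mul_of_nonneg_left (sub_le_sub_right hdist _) hμ.le
  have hK : 0 ≤ ‖A‖ * ‖B‖ * ((min X₀.card Y₀.card : ℕ) : ℝ) *
      Real.exp (-μ * (setDist X₀ Y₀ - v * |t|)) := by positivity
  calc ‖τA * B - B * τA‖ ≤ _ := hmain
    _ = C * (‖A‖ * ‖B‖ * ((min X₀.card Y₀.card : ℕ) : ℝ) *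
          Real.exp (-μ * (setDist X₀ Y₀ - v * |t|))) := by ring
    _ ≤ max C 0 * (‖A‖ * ‖B‖ * ((min X₀.card Y₀.card : ℕ) : ℝ) *
          Real.exp (-μ * (setDist X₀ Y₀ - v * |t|))) :=
        mul_le_mul_of_nonneg_right (le_max_left C 0) hK
    _ ≤ max C 0 * (‖A‖ * ‖B‖ * (X.card : ℝ) * Real.exp (-((L - v * |t|) / (1 / μ)))) := by
        refine mul_le_mul_of_nonneg_left ?_ (le_max_right C 0)
        exact mul_le_mul (mul_le_mul_of_nonneg_left hcard (by positivity)) hexp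
          (Real.exp_pos _).le (by positivity)
    _ = max C 0 * X.card * ‖A‖ * ‖B‖ * Real.exp (-((L - v * |t|) / (1 / μ))) := by ring

/-- **Bravyi–Hastings–Verstraete on `ℤ^d`, from the Lieb–Robinson fact.** Let `Φ` be a Hermitian,
finite-range, bounded interaction on `ℤ^d` and assume the Lieb–Robinson bound `lieb_robinson d q`
(NS06 Thm 1, a named fact of `LiebRobinson.lean`). Then there are `C ≥ 0`, `ξ > 0`, `v > 0`,
depending only on `Φ`, such that in every finite volume `Λ ⊆ ℤ^d`, for every norm-bounded linear
functional `ω` on `𝔄_Λ` (e.g. `vectorState ψ` of a unit vector, `= opExpect · ψ`) whose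
correlations cluster with constants `(c̃, χ)` in the sup-metric of `ℤ^d`, the finite-volume
Heisenberg dynamics `τ_t^Λ` (`heisenbergEvolution` of `H_Λ = Σ_{Z ⊆ Λ} Φ Z`) satisfies
`|⟨τ_t^Λ(A) τ_t^Λ(B)⟩_c| ≤ (2C(|X| + |Y|) + c̃) ‖A‖ ‖B‖ exp(-(L - 2v|t|)/(χ + 2ξ))` for
`A ∈ 𝔄_X`, `B ∈ 𝔄_Y`, `d(X, Y) ≥ L ≥ 0`, uniformly in `Λ`. BHV06 §corr with (LR) supplied by
NS06 Thm 1. [cite: BravyiHastingsVerstraete2006, arXiv Eq. (2) ff.] -/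
theorem lieb_robinson.correlationLightCone (hLR : lieb_robinson d q) (Φ : LatticeInteraction d q)
    {R J : ℝ} (hH : Φ.IsHermitian) (hR : Φ.HasFiniteRange R) (hJ : Φ.IsBounded J) :
    ∃ C ξ v : ℝ, 0 ≤ C ∧ 0 < ξ ∧ 0 < v ∧
      ∀ (Λ : Finset (Site d)) (ω : Op ↥Λ q →ₗ[ℂ] ℂ), (∀ A, ‖ω A‖ ≤ ‖A‖) →
      ∀ (c' χ : ℝ), 0 ≤ c' → 0 < χ →
        (∀ (X Y : Finset ↥Λ) (A B : Op ↥Λ q), IsSupportedOn A X → IsSupportedOn B Y →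
          ∀ L : ℝ, 0 ≤ L → (∀ x ∈ X, ∀ y ∈ Y, L ≤ dist (x : Site d) (y : Site d)) →
            ‖connCorr ω A B‖ ≤ c' * ‖A‖ * ‖B‖ * Real.exp (-(L / χ))) →
        ∀ (t : ℝ) (X Y : Finset ↥Λ) (A B : Op ↥Λ q), IsSupportedOn A X → IsSupportedOn B Y →
          ∀ L : ℝ, 0 ≤ L → (∀ x ∈ X, ∀ y ∈ Y, L ≤ dist (x : Site d) (y : Site d)) →
            ‖connCorr ω (heisenbergEvolution (localHamiltonian (Φ.restrict Λ) univ) t A)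
                (heisenbergEvolution (localHamiltonian (Φ.restrict Λ) univ) t B)‖ ≤
              (2 * C * (X.card + Y.card) + c') * ‖A‖ * ‖B‖ *
                Real.exp (-((L - 2 * v * |t|) / (χ + 2 * ξ))) := by
  obtain ⟨C, ξ, v, hC, hξ, hv, h⟩ := lieb_robinson.commutator_bound hLR Φ hH hR hJ
  refine ⟨C, ξ, v, hC, hξ, hv, ?_⟩
  intro Λ ω hω c' χ hc' hχ hcl t X Y A B hA hB L hL0 hL
  have hHam : (localHamiltonian (Φ.restrict Λ) univ).IsHermitian :=
    localHamiltonian_isHermitian (hH.isLocal_restrict Λ) univ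
  exact norm_connCorr_le_of_commutator_bound (fun x y : ↥Λ => dist (x : Site d) (y : Site d))
    (fun x y => dist_nonneg) (fun x y => dist_comm _ _) (fun x y z => dist_triangle _ _ _) ω hω
    (heisenbergEvolution (localHamiltonian (Φ.restrict Λ) univ) t)
    (fun A => (norm_heisenbergEvolution_holds hHam t A).le) hC hv.le hξ hc' hχ (h Λ t) hcl X Y A B
    hA hB L hL0 hL

end LatticeBridge

end Literature.MathematicalPhysics.QuantumLattice
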